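import Summits.QuantumFields.YangMills.Theorems.UnitScaleTiltFluctuationComparisonRegPrGlobalSlackKernelLegAnalyticOwn
import HarnessLib

/-!
# `UnitScaleTiltFluctuationComparisonRegPrGlobalSlackLegLocalAnalyticT3` — PRINT'S LOCALISATION (p.263 L4 «𝒫₁(g₀,X,U₁) depends on U₁ restricted to X̃₅») TURNS SUP-NORM
# ANALYTICITY (G3D-01) INTO LEG-WEIGHTED ANALYTICITY ((R2′)) WITH A UNIFORM RADIUS LOSS `e^{−κ′R}` (crux `FluctuationComparisonRegPrIntL`, stmt-QuantumFields-20520, skeletons v5kC / v5kD,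
# STUB 3⁗χ; cell `pub/ym-inputs`, seat ym-inputs-p11; count-neutral helper, def-free, registry untouched)

WHY.  The display row (R2′) `ChartAnalyticΦ D (rescaleΦw dist κ′ Φ) κ ρ C_A` (leg-weighted analyticity of the chart family; ⟹ `KernelLegΦ` ✓`kernelLegΦ_of_chartAnalyticLeg` ⟹ the I-11
row (43) ✓`kernelLegPointwiseΦ_of_chartAnalyticLeg`) asks the chart `Φ_{K,b,Y} ∘ D_w` (`D_w z(c) = e^{κ′d(c)}z(c)`) to be holomorphic on the sup-norm ball of radius `ρ` — i.e. `Φ_{K,b,Y}`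
itself on the WEIGHTED polydisc `{|z(c)| < ρe^{κ′d(c)}}`, which is LARGER than the recorded sup-norm ball of G3D-01 (`StepAlphaAC.chart : ChartAnalyticityAsCited (Ψ X) ρ (C25 g e^{−κ dj})`).
The gap closes exactly when the chart does not read the far legs: if `Φ_{K,b,Y}(z) = Φ_{K,b,Y}(z·1_{d ≤ R})` (print's localisation of `𝒫(X)` to `X̃`, a FIXED collar, p.263 L4; (26)'s
«second property»), then `‖(D_w z)·1_{d≤R}‖ ≤ e^{κ′R}‖z‖`, so `Φ ∘ D_w` is holomorphic on the ball of radius `ρe^{−κ′R}` with the same bound — (R2′) with `ρ′ = ρe^{−κ′R}`, UNIFORM as long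
as the collar `R` is (it is: `X̃` is `X` plus a fixed number of cubes, in current-lattice units).  This file proves that mechanism, def-free, with the localisation as an INLINE hypothesis:

* §1 **`chartAnalyticityAsCited_rescale_of_local`** — one chart: `ChartAnalyticityAsCited Ψ ρ M`, `κ′ ≥ 0`, locality `∀ z, Ψ z = Ψ (fun c => if dist K b Y c ≤ R then z c else 0)`
  ⟹ `ChartAnalyticityAsCited (fun z => Ψ (legD dist κ′ K b Y z)) (ρ·e^{−κ′R}) M`;
* §2 **`chartAnalyticOwnΦ_rescaleW_of_local`** — the own-indexed row: `ChartAnalyticOwnΦ D Φ κ ρ C_A` + locality of every listed chart within `R` ⟹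
  `ChartAnalyticOwnΦ D (rescaleΦw dist κ′ Φ) κ (ρ·e^{−κ′R}) C_A` (then ✓`chartAnalyticLegΦ_chi_of_own` / ✓`chartAnalyticΦ_of_own` give the two-clause (R2′) of record).

HONEST SCOPE.  The localisation hypothesis is NOT a recorded row of the (α) package today (`StepAlphaAC` carries `chart`, `inv26`, `bound28`, `far_le`, `hPY`, `hPYZ` — no «reads only X̃»
clause), and it is only print's statement for the NEW-level charts `Ψ_X` (the old-level re-localised charts of (33)–(34)/(43) carry legs up to `R(g)M₁`, NOT a uniform collar: there (R2′)
is the propagator-chain decay of p.264 L20–24, not locality).  So this is the new-level mechanism as a tool for the (α)-record desk, nothing more.  Nothing of [Balaban1985UV3] asserted;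
no summit / rung / gap claim (YM₃ on T³ is ladder rung R3, not the Clay problem).

References: T. Bałaban, CMP 102 (1985) 255–275 [Balaban1985UV3] (p.263 L4, (26) p.263, (29)–(30) p.263, (33)–(34) p.264, (43)–(45) pp.266–267).
-/

set_option autoImplicit false

noncomputable section

open scoped BigOperators
open Metric
open Literature.MathematicalPhysics.QuantumFieldTheory.Balaban1983to89
open Literature.MathematicalPhysics.QuantumFieldTheory.Balaban1983to89.T3ContinuumYM3Torus
open Literature.MathematicalPhysics.QuantumFieldTheory.Balaban1983to89.T3AlphaInputsAC
open Literature.MathematicalPhysics.QuantumFieldTheory.Balaban1985CMP102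
open Literature.MathematicalPhysics.QuantumFieldTheory.Balaban1985CMP102.Binders (ChartAnalyticityAsCited)
open Summit.QuantumFields.YangMills.Theorems
open Summit.QuantumFields.YangMills.Theorems.GlobalSlackKernelMatching

namespace Summit.QuantumFields.YangMills.Theorems.GlobalSlackKernelLeg

/-! ## §1 One chart: locality + sup-norm analyticity ⟹ analyticity of the leg-rescaled chart on the shrunk ball -/

section OneChart

variable {𝕍 : Type} [NormedAddCommGroup 𝕍] [NormedSpace ℂ 𝕍] {F : T3Family}

/-- The TRUNCATED WEIGHTED configuration `c ↦ 1_{d(c) ≤ R}·e^{κ′d(c)}·z(c)` has sup norm `≤ e^{κ′R}·‖z‖` (`κ′ ≥ 0`). [cite: Balaban1985UV3, (45) p.267] -/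
theorem norm_trunc_legD_le (dist : LegDist F) {κ' R : ℝ} (hκ' : 0 ≤ κ') (K b : ℕ) (Y : Set (Site (F.P K) 0)) (z : PBond (F.P K) b → 𝕍) :
    ‖(fun c => if dist K b Y c ≤ R then legD 𝕍 dist κ' K b Y z c else 0)‖ ≤ Real.exp (κ' * R) * ‖z‖ := by
  classical
  refine (pi_norm_le_iff_of_nonneg (by positivity)).mpr fun c => ?_
  by_cases hc : dist K b Y c ≤ R
  · rw [if_pos hc, legD_apply, norm_smul, norm_legW]
    exact mul_le_mul (Real.exp_le_exp.mpr (by nlinarith)) (norm_le_pi_norm z c) (norm_nonneg _) (Real.exp_pos _).le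
  · rw [if_neg hc, norm_zero]; positivity

/-- The truncated weighted configuration is a continuous linear function of `z` (a coordinatewise scaling of a finite product); in particular differentiable. [folklore] -/
theorem differentiable_trunc_legD (dist : LegDist F) (κ' R : ℝ) (K b : ℕ) (Y : Set (Site (F.P K) 0)) :
    Differentiable ℂ fun z : PBond (F.P K) b → 𝕍 => (fun c => if dist K b Y c ≤ R then legD 𝕍 dist κ' K b Y z c else 0) := by
  classical
  refine differentiable_pi.mpr fun c => ?_
  by_cases hc : dist K b Y c ≤ R
  · simp only [if_pos hc, legD_apply]
    exact (differentiable_apply (𝕜 := ℂ) c).const_smul _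
  · simp only [if_neg hc]
    exact differentiable_const _

/-- **LOCALITY + SUP-NORM ANALYTICITY ⟹ LEG-WEIGHTED ANALYTICITY, ONE CHART**: if `Ψ` reads only the legs within distance `R` of the domain (`Ψ z = Ψ (z·1_{d≤R})`), is holomorphic on
`ball 0 ρ` and bounded by `M` on `closedBall 0 (ρ/2)`, then `Ψ ∘ D_w` (`D_w = legD dist κ′ K b Y`, `κ′ ≥ 0`) is holomorphic on `ball 0 (ρe^{−κ′R})` and bounded by `M` on
`closedBall 0 (ρe^{−κ′R}/2)`. [cite: Balaban1985UV3, p.263 L4, (29)-(30) p.263, (45) p.267] -/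
theorem chartAnalyticityAsCited_rescale_of_local {K b : ℕ} {Y : Set (Site (F.P K) 0)} {Ψ : (PBond (F.P K) b → 𝕍) → ℂ} {ρ M : ℝ} (dist : LegDist F)
    {κ' R : ℝ} (hκ' : 0 ≤ κ') (h : ChartAnalyticityAsCited Ψ ρ M)
    (hloc : ∀ z : PBond (F.P K) b → 𝕍, Ψ z = Ψ (fun c => if dist K b Y c ≤ R then z c else 0)) :
    ChartAnalyticityAsCited (fun z => Ψ (legD 𝕍 dist κ' K b Y z)) (ρ * Real.exp (-(κ' * R))) M := by
  classical
  obtain ⟨hρ, hdiff, hbd⟩ := h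
  have hE : 0 < Real.exp (-(κ' * R)) := Real.exp_pos _
  have hEE : Real.exp (κ' * R) * Real.exp (-(κ' * R)) = 1 := by rw [← Real.exp_add, add_neg_cancel, Real.exp_zero]
  -- the rescaled chart factors through the truncated weighted configuration
  have hfac : (fun z => Ψ (legD 𝕍 dist κ' K b Y z)) =
      Ψ ∘ fun z => (fun c => if dist K b Y c ≤ R then legD 𝕍 dist κ' K b Y z c else 0) := by
    funext z; exact hloc _
  refine ⟨by positivity, ?_, ?_⟩
  · rw [hfac]
    refine hdiff.comp (differentiable_trunc_legD dist κ' R K b Y).differentiableOn fun z hz => ?_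
    rw [mem_ball_zero_iff] at hz ⊢
    calc ‖(fun c => if dist K b Y c ≤ R then legD 𝕍 dist κ' K b Y z c else 0)‖ ≤ Real.exp (κ' * R) * ‖z‖ := norm_trunc_legD_le dist hκ' K b Y z
      _ < Real.exp (κ' * R) * (ρ * Real.exp (-(κ' * R))) := mul_lt_mul_of_pos_left hz (Real.exp_pos _)
      _ = ρ := by rw [mul_comm ρ, ← mul_assoc, hEE, one_mul]
  · intro z hz
    show ‖Ψ (legD 𝕍 dist κ' K b Y z)‖ ≤ M
    rw [hloc]
    refine hbd _ ?_
    rw [mem_closedBall_zero_iff] at hz ⊢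
    calc ‖(fun c => if dist K b Y c ≤ R then legD 𝕍 dist κ' K b Y z c else 0)‖ ≤ Real.exp (κ' * R) * ‖z‖ := norm_trunc_legD_le dist hκ' K b Y z
      _ ≤ Real.exp (κ' * R) * (ρ * Real.exp (-(κ' * R)) / 2) := mul_le_mul_of_nonneg_left hz (Real.exp_pos _).le
      _ = ρ / 2 := by rw [mul_div_assoc', mul_comm ρ, ← mul_assoc, hEE, one_mul]

end OneChart

/-! ## §2 The own-indexed row: locality of every listed chart ⟹ (R2′) for the leg-rescaled family on the shrunk ball -/

section Family

variable {𝕍 : Type} [NormedAddCommGroup 𝕍] [NormedSpace ℂ 𝕍] {F : T3Family} {γ : ℝ}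

/-- **(R2′) FROM G3D-01-TYPE SUP-NORM ANALYTICITY AND A UNIFORM LOCALISATION COLLAR**: if every listed chart `Φ K b Y` (`Y ∈ Loc K k triv (1+b)`) reads only the legs with `dist K b Y c ≤ R`
and `ChartAnalyticOwnΦ D Φ κ ρ C_A` holds, then `ChartAnalyticOwnΦ D (rescaleΦw dist κ′ Φ) κ (ρ·e^{−κ′R}) C_A` for every `κ′ ≥ 0` — the own-indexed leg-weighted analyticity row with a
UNIFORM radius loss. [cite: Balaban1985UV3, p.263 L4, (29)-(30) p.263, (43)-(45) pp.266-267] -/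
theorem chartAnalyticOwnΦ_rescaleW_of_local {D : AlphaDataT3 F γ} {Φ : ChartFam 𝕍 F} (dist : LegDist F) {κ' R κ ρ C_A : ℝ} (hκ' : 0 ≤ κ')
    (hloc : ∀ (K k b : ℕ) (Y : Set (Site (F.P K) 0)), Y ∈ D.Loc K k (D.triv K k) (1 + b) →
      ∀ z : PBond (F.P K) b → 𝕍, Φ K b Y z = Φ K b Y (fun c => if dist K b Y c ≤ R then z c else 0))
    (h : ChartAnalyticOwnΦ D Φ κ ρ C_A) : ChartAnalyticOwnΦ D (rescaleΦw dist κ' Φ) κ (ρ * Real.exp (-(κ' * R))) C_A :=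
  fun K k b Y hY => chartAnalyticityAsCited_rescale_of_local dist hκ' (h K k b Y hY) (hloc K k b Y hY)

end Family

end Summit.QuantumFields.YangMills.Theorems.GlobalSlackKernelLeg

end
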